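import Literature.AlgebraicGeometry.HodgeTheory.UniversalHypersurfaceDiscriminant
import Literature.Computability.AlgebraicComplexity.FormSingularLocusHeight
import HarnessLib

/-!
# The discriminant of degree-`d` forms on `ℙⁿ⁺¹` exists and is irreducible — PROVED
# (the degree-free part of the named fact `discriminantForm_irreducible`)

Family `hodge`, layer `Literature/AlgebraicGeometry/HodgeTheory`; theorems only (no definition, no named fact).

`Literature/AlgebraicGeometry/HodgeTheory/UniversalHypersurfaceDiscriminant.lean` records F-DISC-0
(`discriminantForm_irreducible`, Eisenbud–Harris Prop. 7.1 (c) + 7.4) as a NAMED FACT: for `d ≥ 2` an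
IRREDUCIBLE polynomial `Disc` in the coefficients `a_m` with `singularCoeffs n d = V(Disc)`, homogeneous of
degree `(n+2)(d−1)ⁿ⁺¹`.  Everything except the value of the degree is a THEOREM of the tree: the cell
`val-lit` (`Literature/Computability/AlgebraicComplexity/FormSingularLocusPrime`, `…Subfamily`, `…Height`,
`FormDiscriminantExists/Homogeneous`) proved that the singular forms of degree `D ≥ 2` in `n + 2` variables are
the zero set of a PRIME polynomial in the coefficients (Gelfand–Kapranov–Zelevinsky Ch. 1 §1), by a
resultant-free route (the polynomial family `A · singBaseForm`, primality of its kernel, height one by the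
dimension formula).  This file transports that theorem to the Hodge-theory vocabulary (index type
`DegIndex n d = {m // m.degree = d}` vs `DegIdx (Fin (n+2)) d = ↥(finsuppAntidiag d)`, `formOfCoeffs` /
`singularCoeffs` vs `formCoeff` / `IsNonsingularForm`):

* `exists_irreducible_discriminantForm` — for `2 ≤ d`: `∃ Disc : ℂ[a_m], Irreducible Disc ∧
  ∀ a, a ∈ singularCoeffs n d ↔ eval a Disc = 0` (with homogeneity of positive degree:
  `exists_irreducible_isHomogeneous_discriminantForm`).

So the consumers of F-DISC-0 that never use the numerical degree (crux K1-B of the Hodge cell: pieces GEN,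
LINK-G; `discriminantForm_irreducible.range_coeffVector_eq`, `….isPathConnected_univ`) can be fed by a theorem.
The exact degree `(n+2)(d−1)ⁿ⁺¹` (Eisenbud–Harris Prop. 7.4) is NOT proved here.

## References

* [GelfandKapranovZelevinsky1994] I. M. Gelfand, M. M. Kapranov, A. V. Zelevinsky, *Discriminants, Resultants,
  and Multidimensional Determinants*, Birkhäuser 1994, Ch. 1 §1.
* [EisenbudHarris2016] D. Eisenbud, J. Harris, *3264 and All That*, CUP 2016, §7.1 Prop. 7.1 (c).
-/

noncomputable section

open MvPolynomial
open Literature.AlgebraicGeometry.Motives Literature.AlgebraicGeometry.Motives.UniversalHypersurface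
open Literature.Computability.AlgebraicComplexity

namespace Literature.AlgebraicGeometry.HodgeTheory

variable {n d : ℕ}

/-- The `val-lit` coefficient vector `formCoeff d (formOfCoeffs a)` is `a` read through the identification
`DegIndex n d = {m // m.degree = d} ≃ DegIdx (Fin (n+2)) d = {m // m ∈ finsuppAntidiag d}`
(`Equiv.subtypeEquivRight`). [folklore] -/
private theorem formCoeff_formOfCoeffs (a : DegIndex n d → ℂ) :
    formCoeff d (formOfCoeffs a) =
      a ∘ (Equiv.subtypeEquivRight (fun _ => (mem_degMonomials_iff (σ := Fin (n + 2))).symm) :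
        DegIndex n d ≃ DegIdx (Fin (n + 2)) d).symm := by
  funext e
  rw [formCoeff_apply, Function.comp_apply]
  exact coeff_formOfCoeffs a
    ((Equiv.subtypeEquivRight (fun _ => (mem_degMonomials_iff (σ := Fin (n + 2))).symm) :
        DegIndex n d ≃ DegIdx (Fin (n + 2)) d).symm e)

/-- **The discriminant exists and is irreducible** (degree-free part of F-DISC-0, PROVED): for `d ≥ 2` there
is an irreducible `Disc ∈ ℂ[a_m : |m| = d]` such that a coefficient vector `a` is singular
(`a ∈ singularCoeffs n d`) iff `Disc(a) = 0`.  Transport of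
`Literature.Computability.AlgebraicComplexity.FormDiscriminant.exists_prime_discriminant`.
[cite: GelfandKapranovZelevinsky1994, Ch. 1 §1 (the discriminant hypersurface)]
[cite: EisenbudHarris2016, §7.1 Prop. 7.1 (c)] -/
theorem exists_irreducible_discriminantForm (hd : 2 ≤ d) :
    ∃ Disc : MvPolynomial (DegIndex n d) ℂ, Irreducible Disc ∧
      ∀ a : DegIndex n d → ℂ, a ∈ singularCoeffs n d ↔ MvPolynomial.eval a Disc = 0 := by
  obtain ⟨Δ, hΔ, -, -, -, hiff⟩ := FormDiscriminant.exists_prime_discriminant (n := n) (D := d) hd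
  let e : DegIndex n d ≃ DegIdx (Fin (n + 2)) d :=
    Equiv.subtypeEquivRight fun _ => (mem_degMonomials_iff (σ := Fin (n + 2))).symm
  refine ⟨rename e.symm Δ, ?_, fun a => ?_⟩
  · exact (MulEquiv.irreducible_iff (renameEquiv ℂ e.symm).toMulEquiv).mpr hΔ.irreducible
  · rw [mem_singularCoeffs_iff, ← hiff (formOfCoeffs a) (isHomogeneous_formOfCoeffs a), eval_rename,
      formCoeff_formOfCoeffs, MvPolynomial.aeval_eq_eval]

/-- The same with homogeneity of positive degree recorded (the numerical value `(n+2)(d−1)ⁿ⁺¹` of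
Eisenbud–Harris Prop. 7.4 is not proved here). Transport of
`FormDiscriminant.exists_prime_isHomogeneous_discriminant`.
[cite: GelfandKapranovZelevinsky1994, Ch. 1 §1 (the discriminant hypersurface)] -/
theorem exists_irreducible_isHomogeneous_discriminantForm (hd : 2 ≤ d) :
    ∃ Disc : MvPolynomial (DegIndex n d) ℂ, Irreducible Disc ∧
      Disc.IsHomogeneous Disc.totalDegree ∧ 0 < Disc.totalDegree ∧
      ∀ a : DegIndex n d → ℂ, a ∈ singularCoeffs n d ↔ MvPolynomial.eval a Disc = 0 := by
  obtain ⟨Δ, hΔ, hhom, hpos, -, -, -, hiff⟩ :=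
    FormDiscriminant.exists_prime_isHomogeneous_discriminant (n := n) (D := d) hd
  let e : DegIndex n d ≃ DegIdx (Fin (n + 2)) d :=
    Equiv.subtypeEquivRight fun _ => (mem_degMonomials_iff (σ := Fin (n + 2))).symm
  have hdeg : (rename e.symm Δ).totalDegree = Δ.totalDegree := totalDegree_renameEquiv e.symm Δ
  refine ⟨rename e.symm Δ, ?_, ?_, ?_, fun a => ?_⟩
  · exact (MulEquiv.irreducible_iff (renameEquiv ℂ e.symm).toMulEquiv).mpr hΔ.irreducible
  · rw [hdeg]; exact hhom.rename_isHomogeneous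
  · rw [hdeg]; exact hpos
  · rw [mem_singularCoeffs_iff, ← hiff (formOfCoeffs a) (isHomogeneous_formOfCoeffs a), eval_rename,
      formCoeff_formOfCoeffs, MvPolynomial.aeval_eq_eval]

/-- **Consumer shape** (theorem version of `discriminantForm_irreducible.range_coeffVector_eq`): for `d ≥ 2` the
image of the chart `U(ℂ) → ℂ^{DegIndex n d}` is the complement of an irreducible hypersurface `V(Disc)`.
[cite: GelfandKapranovZelevinsky1994, Ch. 1 §1 (the discriminant hypersurface)] -/
theorem exists_irreducible_range_coeffVector_eq (hd : 2 ≤ d) :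
    ∃ Disc : MvPolynomial (DegIndex n d) ℂ, Irreducible Disc ∧
      Set.range (coeffVector ℂ n d : ComplexPoints (base ℂ n d) → _) =
        {a | MvPolynomial.eval a Disc ≠ 0} := by
  obtain ⟨Disc, hirr, hV⟩ := exists_irreducible_discriminantForm (n := n) hd
  refine ⟨Disc, hirr, ?_⟩
  rw [← compl_singularCoeffs_eq_range_coeffVector]
  ext a
  simp only [Set.mem_compl_iff, Set.mem_setOf_eq, hV]

/-- **`U(ℂ)` is path connected, unconditionally** (`d ≥ 2`): theorem version of
`discriminantForm_irreducible.pathConnectedSpace`. [cite: Shafarevich1994, VII §2.1 Lemma 7.2] -/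
theorem pathConnectedSpace_complexPoints_base (hd : 2 ≤ d) : PathConnectedSpace (ComplexPoints (base ℂ n d)) := by
  obtain ⟨Disc, hirr, hV⟩ := exists_irreducible_discriminantForm (n := n) hd
  have hS := isPathConnected_compl_singularCoeffs_of_eq hirr.ne_zero hV
  have hJ : ∀ a : ↥(singularCoeffs n d)ᶜ,
      SmoothHypersurface.IsNonsingularForm ℂ (formOfCoeffs (a.1 : DegIndex n d → ℂ)) := fun a =>
    not_not.mp a.2
  have hcont : Continuous fun a : ↥(singularCoeffs n d)ᶜ => pointOfCoeffs ℂ n d a.1 (hJ a) :=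
    continuous_pointOfCoeffs_comp ℂ n d continuous_subtype_val hJ
  haveI : PathConnectedSpace ↥(singularCoeffs n d)ᶜ := isPathConnected_iff_pathConnectedSpace.mp hS
  have hrange : Set.range (fun a : ↥(singularCoeffs n d)ᶜ => pointOfCoeffs ℂ n d a.1 (hJ a)) =
      Set.univ := by
    refine Set.eq_univ_of_forall fun s => ?_
    have hs : coeffVector ℂ n d s ∈ (singularCoeffs n d)ᶜ := by
      rw [compl_singularCoeffs_eq_range_coeffVector]
      exact ⟨s, rfl⟩
    exact ⟨⟨coeffVector ℂ n d s, hs⟩, pointOfCoeffs_coeffVector ℂ n d s _⟩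
  rw [pathConnectedSpace_iff_univ, ← hrange]
  exact isPathConnected_range hcont

end Literature.AlgebraicGeometry.HodgeTheory

end
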